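import Mathlib
import HarnessLib
import Summits.Langlands.Langlands.Theses.EvenArtinGL4Door
import Literature.NumberTheory.GaloisRepresentations.SymplecticMultiplier

/-!
# Birth skeleton (BC3) for crux stmt-Langlands-2904
`Summit.Langlands.Langlands.Theses.EvenArtinGL4Door.TwoAdicProAutomorphyGL4` — line `birth`

Route `route-Langlands-EvenArtinGL4Door` (`closes : ResidualDoorMod2 → TwoAdicProAutomorphyGL4 →
ArtinLimitClassicalityGL4 → RealQuadraticDoorDescent → EvenArtinJunction → Langlands`).  The crux
(rank 2, "2-ADIC PRO-AUTOMORPHY OF THE DOOR `R = Ind_L^ℚ(ρ|_L ⊗ ψ)` ON `GL₄/ℚ`", typed as its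
characteristic-0 shadow) says: for `ρ : Γ_ℚ → GL₂(ℂ)` irreducible (ANY parity, any projective type),
`L` real quadratic with `2 ∤ disc L`, `ψ : Γ_L → ℂˣ` of mixed signature with no `ψ^(2^a)` descending to
`ℚ`, and `R : Γ_ℚ → GL₄(ℂ)` an irreducible framed model of `Ind_L^ℚ(ρ|_L ⊗ ψ)` which is residually
automorphic mod 2 from a REGULAR algebraic cuspidal `Π₀` of `GL₄(𝔸_ℚ)` (coefficientwise congruence
`< 1` in `ℚ̄₂` between `ι⁻¹ charpoly R(Frob_v)` and the arithmetic-Frobenius polynomial of `r_ι(Π₀)` at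
almost all `v`), `R` is a 2-adic limit of regular algebraic cuspidal `Π_s` (same congruence to precision
`(1/2)^s`, every `s`).

This file concludes the crux BY NAME from four named stubs.  The cut follows the route header's own
two-layer plan ("TwoAdicProAutomorphyGL4 ⇐ BigRTUnpolarisedGL4 → OrdinaryGSp4FamilyAtArtinPoint") and its
diagnosis of WHY the door is hard (rationale (2)–(3): `R` is essentially self-dual of SYMPLECTIC type
through the hyperbolic form on `Ind`, with multiplier of parity `−det ρ(c)`, while every regular-weight
automorphic lift of `R̄₂` that present technology supplies (`AI(g)`, `f ⊠ θ`) is polarised in a DIFFERENT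
component — so polarised patching cannot reach `x_R` from `Π₀`, and regular classical points accumulate at
`x_R` only through a `GSp₄` family), typed in characteristic-0 / residual shadows over existing vocabulary
(`FramedGaloisRep.IsSymplecticWithMultiplier`, `FramedGaloisRep.IsOdd`, Mathlib `Representation.tprod`,
`Representation.Equiv`):

* `stub_doorStructure` — STRUCTURE OF THE DOOR (provable; size L in Lean).  From the door data and the
  irreducibility of `R` alone (no parity, no `2 ∤ disc L`, no non-descent clause): (i) the TENSOR MODEL
  `R ≃ ρ ⊗ θ` with `θ` (a framed `Ind_L^ℚ ψ`) ODD — mixed signature makes `θ(c) ∼ diag(1, −1)` — by the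
  projection formula `Ind_L^ℚ(ρ|_L ⊗ ψ) ≅ ρ ⊗ Ind_L^ℚ ψ`; (ii) the HYPERBOLIC SYMPLECTIC POLARISATION:
  `∧²R ⊇ det ρ ⊗ Sym² θ ⊇ det ρ · (ψ ∘ Ver)`, so `R` preserves a non-degenerate (by irreducibility of `R`)
  alternating form up to the character `χ_S = det ρ · (ψ ∘ Ver_{L/ℚ})`, and at every complex conjugation
  `χ_S(c) = det ρ(c) ψ(c₁) ψ(c₂) = −det ρ(c)`; (iii) the PARITY DICHOTOMY `det ρ(c) = +1` for all `c` or
  `−1` for all `c` (complex conjugations of `Γ_ℚ` are conjugate; `c² = 1`).  This is the header's "new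
  observation" made a lemma: for EVEN `ρ` the door `R` is `GSp₄`-ODD (the abelian-surface parity).
* `stub_polarisedResidualLift` — CROSSING TO THE POLARISED COMPONENT (the residual shadow of the header's
  `BigRTUnpolarisedGL4`; open).  An irreducible `R : Γ_ℚ → GL₄(ℂ)`, symplectic with multiplier `χ`, which
  is residually automorphic mod 2 from SOME regular algebraic cuspidal `Π₀` of `GL₄(𝔸_ℚ)`, is residually
  automorphic mod 2 from a regular algebraic cuspidal `Π₀'` lying in `R`'s OWN polarised component: `Π₀'`
  comes with a 2-adic `r' : Γ_ℚ → GL₄(ℚ̄₂)` matching it exactly at almost all `v` which is symplectic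
  with multiplier `χ' ≡ ι⁻¹ χ (mod 𝔪_{ℤ̄₂})` (`PolarisedResidAutomorphicMod2`).  Intended proof: big
  `R^{unpol}_{R̄₂,S} = 𝐓(K²)_𝔪` on completed cohomology of `GL₄/ℚ` at `𝔪 = 𝔪_{R̄₂}` (`l₀ = 1`:
  Calegari–Geraghty / Gee–Newton / Hansen Conj. 1.2.3, conditional in print) makes EVERY deformation of
  `R̄₂` pro-automorphic, in particular a regular de Rham symplectic lift with multiplier lifting `χ̄`
  (exists: Fakhruddin–Khare–Patrikis-type lifting; `R` itself witnesses unobstructedness in weight 0),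
  whose automorphy is then a polarised (`GSp₄`, `l₀ = 0`) classicality statement.  Parity-blind (it is a
  statement about `R̄₂`; `−1 ≡ 1 mod 2`), as it must be: the door's `Π₀ = AI_L^ℚ(g)` is symplectic with
  multiplier extending `det r_g` — congruent to `det ρ̄ · ψ̄²`, NOT to `χ̄_S = det ρ̄ · ψ̄ψ̄^τ`
  (`ψ̄^τ ≠ ψ̄` by absolute irreducibility of `R̄₂`), which is exactly the header's "two polarised
  components meet only in the unpolarised deformation space".
* `stub_polarisedAccumulation` — THE `GSp₄`-ODD FAMILY AT THE ARTIN POINT (the shadow of the header's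
  `OrdinaryGSp4FamilyAtArtinPoint`; open, but inside the `l₀ = 0` technique class).  An irreducible
  `R : Γ_ℚ → GL₄(ℂ)`, symplectic with ODD multiplier (`χ(c) = −1`), residually automorphic mod 2 inside
  its own polarised component, is a 2-adic limit of regular algebraic cuspidal `Π_s` of `GL₄(𝔸_ℚ)`
  (`LimitToPrecision ι R s` for every `s`).  Intended proof: polarised `R^{pol} = 𝐓^{GSp₄}_𝔪` at
  `p = 2` (Boxer–Calegari–Gee–Pilloni-type patching of (higher) Hida / overconvergent coherent
  cohomology of Siegel threefolds, `l₀(GSp₄) = 0`) puts `x_R` on the tame-level-`N` `GSp₄` eigenvariety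
  as a (non-classical, weight "(1,2)") Artin point à la Bellaïche–Chenevier; the cuspidal eigenvariety is
  equidimensional over weight space, so regular classical points ACCUMULATE at `x_R` (small-slope
  classicality at weights `2`-adically close to `w(x_R)`); transfer `GSp₄ → GL₄` (Arthur's
  classification) of the stable approximants gives cuspidal `Π_s`.  Odd multiplier is essential:
  regular algebraic symplectic `Π` on `GL₄/ℚ` have odd similitude, so an even-multiplier symplectic
  Artin point lies in a component with NO classical points (Calegari–Mazur / Ash–Pollack–Stevens
  rigidity) — which is why the door needs `ρ` EVEN here, and why the classical parity goes elsewhere: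
* `stub_oddTensorLimit` — THE CLASSICAL PARITY (`GO₄ ≅ GL₂ × GL₂` technology; theorem-sized where both
  factors have finite slope at 2, open at infinite slope).  If `R ≃ r₁ ⊗ r₂` with `r₁, r₂ : Γ_ℚ → GL₂(ℂ)`
  both ODD and `R` irreducible, then `R` is a 2-adic limit of regular algebraic cuspidal `Π_s` of
  `GL₄(𝔸_ℚ)`: `r₁, r₂` are modular of weight one (Khare–Wintenberger + Kisin), the weight-`k`, `k'`
  members `f_k ≡ f`, `g_{k'} ≡ g (mod 2^s)` of the 2-adic (Hida / Coleman) families through the two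
  weight-one points give `Π_s = f_k ⊠ g_{k'}` (Ramakrishnan), cuspidal and regular (`HT {0, k'−1, k−1,
  k+k'−2}`) for `k ≠ k'` large.  In the door with `ρ` odd this is the case `r₁ = ρ`, `r₂ = θ_ψ`.

Composition `TwoAdicProAutomorphyGL4_of` (kernel-checked, no `sorry`, not a one-line seam): unfold the
crux clause by clause (`crux_iff`, `Iff.rfl`); `stub_doorStructure` gives the tensor model, the symplectic
datum `(χ, parity)` and the dichotomy; EVEN `ρ` ⇒ `χ(c) = −det ρ(c) = −1` ⇒ `stub_polarisedResidualLift`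
then `stub_polarisedAccumulation`; ODD `ρ` ⇒ `stub_oddTensorLimit` on `R ≃ ρ ⊗ θ`.  All four stubs are
load-bearing.  The crux's hypotheses `ρ` irreducible, `2 ∤ disc L` and "no `ψ^(2^a)` descends" are not
consumed (they serve `ResidualDoorMod2` / `RealQuadraticDoorDescent`), so the skeleton proves slightly
more than the crux.

Shape (for `ledger skeleton check` / `#h21_check_skeleton`): §0 names the crux's clauses as `def`s
(VERBATIM copies; `crux_iff` is `Iff.rfl`, which certifies it); each stub is
`theorem stub_<name> (binders) : <conclusion> := by sorry`; `_Goal.stub_<name> : Prop := type_of%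
@stub_<name>` names that statement; `TwoAdicProAutomorphyGL4_of (hA : _Goal.stub_doorStructure)
(hB : _Goal.stub_polarisedResidualLift) (hC : _Goal.stub_polarisedAccumulation)
(hD : _Goal.stub_oddTensorLimit) : TwoAdicProAutomorphyGL4` is proved without `sorry` and concludes the
route decl BY NAME; the last `example` feeds the four stubs to it.

Disproof used: none — `ledger crux ls stmt-Langlands-2904` shows no workfiles (no `Disproof.lean`, no
`Negative/` lemma, no dead line) at registration time (2026-08-17).  BC3 probes (planner folder
`bc/probe_all.lean`): for each stub, `stub → TwoAdicProAutomorphyGL4` and `stub → Langlands` by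
`first | exact? | simpa | aesop` FAIL (recorded in NOTES.md with rc and the unsolved goals).
-/

set_option linter.dupNamespace false

noncomputable section

namespace Summit.Langlands.Langlands.Cruxes.TwoAdicProAutomorphyGL4.Birth

open Summit.Langlands.Langlands.Theses.EvenArtinGL4Door
open scoped BigOperators Topology Manifold Classical MeasureTheory ProbabilityTheory Matrix InnerProductSpace ComplexConjugate ContinuousMap
open Filter Set Function TopologicalSpace MeasureTheory
open Literature.NumberTheory.GaloisRepresentations Literature.NumberTheory.Automorphic Polynomial NumberField IsDedekindDomain Field

/-! ## 0. Named copies of the crux's clauses (verbatim; `crux_iff` below is `Iff.rfl`) -/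

/-- **Door data** (verbatim the fifth hypothesis of the crux): `ψ` has MIXED SIGNATURE (two complex
conjugations of `Γ_L`, at real places `φ₁, φ₂`, with `ψ c₁ ≠ ψ c₂`), NO `ψ^(2^a)` IS A RESTRICTION FROM
`ℚ`, and `R` is a framed model of `Ind_L^ℚ(σ)` with `σ = ψ • ρ|_L` entrywise. [folklore] -/
def DoorData (ρ : FramedGaloisRep ℚ ℂ 2) (L : Type) [Field L] [NumberField L]
    (ψ : FramedGaloisRep L ℂ 1) (R : FramedGaloisRep ℚ ℂ 4) : Prop :=
  (∃ (φ₁ φ₂ : L →+* ℝ) (c₁ c₂ : Field.absoluteGaloisGroup L), IsComplexConjugation φ₁ c₁ ∧ IsComplexConjugation φ₂ c₂ ∧ ψ c₁ ≠ ψ c₂) ∧ (∀ (a : ℕ) (χ : FramedGaloisRep ℚ ℂ 1), ∃ g : Field.absoluteGaloisGroup L, (ψ g) ^ (2 ^ a) ≠ χ (absGaloisRestrict ℚ L g)) ∧ (∃ σ : FramedGaloisRep L ℂ 2, (∀ g : Field.absoluteGaloisGroup L, ((σ g : Matrix.GeneralLinearGroup (Fin 2) ℂ) : Matrix (Fin 2)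 (Fin 2) ℂ) = ((ψ g : Matrix.GeneralLinearGroup (Fin 1) ℂ) : Matrix (Fin 1) (Fin 1) ℂ) 0 0 • ((FramedGaloisRep.restrictField L ρ g : Matrix.GeneralLinearGroup (Fin 2) ℂ) : Matrix (Fin 2) (Fin 2) ℂ)) ∧ Nonempty (R.toGaloisRep.toRepresentation.Equiv (Representation.ind (absGaloisRestrict ℚ L).toMonoidHom σ.toGaloisRep.toRepresentation)))

/-- **Residual automorphy mod 2 in regular weight** (verbatim the seventh hypothesis of the crux): some
regular algebraic cuspidal `Π₀` of `GL₄(𝔸_ℚ)` has `ι⁻¹`(arithmetic-Frobenius polynomial of `r_ι(Π₀)`)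
`≡ ι⁻¹(charpoly R(Frob_v))` coefficientwise modulo the maximal ideal of `ℤ̄₂` (`‖·‖ < 1` in `ℚ̄₂`) at
almost all `v`. [folklore] -/
def ResidAutomorphicMod2 (ι : PadicAlgCl 2 ≃+* ℂ) (R : FramedGaloisRep ℚ ℂ 4) : Prop :=
  ∃ (hcpt : isCompact_glFiniteIntegralLevel 4 ℚ) (π₀ : CuspidalAutomorphicRepData 4 ℚ hcpt), π₀.1.IsRegularAlgebraic ∧ (∀ᶠ v : IsDedekindDomain.HeightOneSpectrum (NumberField.RingOfIntegers ℚ) in Filter.cofinite, ∃ (α : Multiset ℂ) (P : Polynomial ℂ), π₀.1.HasSatakeParamAt v α ∧ R.IsUnramifiedAt v ∧ R.HasFrobCharpolyAt v P ∧ ∀ i : ℕ, ‖(P.map (ι.symm : ℂ →+* PadicAlgCl 2)).coeff i - (arithFrobPolyOfSatake ι v.residueCard 4 α).coeff i‖ < 1)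

/-- **`R` is automorphic to precision `2^(−s)`** (verbatim the conclusion of the crux at `s`): some regular
algebraic cuspidal `Π` of `GL₄(𝔸_ℚ)` has the congruence of `ResidAutomorphicMod2` to precision
`(1/2)^s` at almost all `v`; "`R` is a 2-adic limit of regular algebraic cuspidal representations" is
`∀ s, LimitToPrecision ι R s`. [folklore] -/
def LimitToPrecision (ι : PadicAlgCl 2 ≃+* ℂ) (R : FramedGaloisRep ℚ ℂ 4) (s : ℕ) : Prop :=
  ∃ (hcpt : isCompact_glFiniteIntegralLevel 4 ℚ) (π : CuspidalAutomorphicRepData 4 ℚ hcpt), π.1.IsRegularAlgebraic ∧ (∀ᶠ v : IsDedekindDomain.HeightOneSpectrum (NumberField.RingOfIntegers ℚ) in Filter.cofinite, ∃ (α : Multiset ℂ) (P : Polynomial ℂ), π.1.HasSatakeParamAt v α ∧ R.IsUnramifiedAt v ∧ R.HasFrobCharpolyAt v P ∧ ∀ i : ℕ, ‖(P.map (ι.symm : ℂ →+* PadicAlgCl 2)).coeff i - (arithFrobPolyOfSatake ι v.residueCard 4 α).coeff i‖ ≤ (1 / 2 : ℝ) ^ s)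

/-- The crux, clause by clause (definitional unfolding of §0; certifies the copies are verbatim). [folklore] -/
theorem crux_iff : TwoAdicProAutomorphyGL4 ↔
    ∀ (ι : PadicAlgCl 2 ≃+* ℂ) (ρ : FramedGaloisRep ℚ ℂ 2) (L : Type) [Field L] [NumberField L]
      (ψ : FramedGaloisRep L ℂ 1) (R : FramedGaloisRep ℚ ℂ 4),
      ρ.toGaloisRep.IsIrreducible → Module.finrank ℚ L = 2 → NumberField.IsTotallyReal L →
        ¬ (2 : ℤ) ∣ NumberField.discr L → DoorData ρ L ψ R → R.toGaloisRep.IsIrreducible →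
          ResidAutomorphicMod2 ι R → ∀ s : ℕ, LimitToPrecision ι R s :=
  Iff.rfl

/-! ## 1. The intermediate notion: residual automorphy INSIDE the polarised component of `R` -/

/-- **Polarised residual automorphy mod 2** of `R` with respect to the multiplier `χ`: there are a regular
algebraic cuspidal `Π₀` of `GL₄(𝔸_ℚ)` and a 2-adic `r : Γ_ℚ → GL₄(ℚ̄₂)` ("the" Galois representation of
`Π₀` along `ι`: unramified with arithmetic-Frobenius polynomial `arithFrobPolyOfSatake ι q_v 4 α` for the
Satake parameter `α` of `Π₀` at almost all `v`) such that `r` is SYMPLECTIC with a multiplier `χ'`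
congruent to `ι⁻¹ ∘ χ` modulo the maximal ideal of `ℤ̄₂` (valuewise `‖χ'(g) − ι⁻¹(χ(g))‖ < 1`), and
`Π₀ ≡ R (mod 𝔪)` coefficientwise at almost all `v` as in `ResidAutomorphicMod2`.  In words: `R̄₂` has a
regular-weight automorphic lift in ITS OWN polarised (`GSp₄`, similitude `≡ χ`) deformation component.
[cite: BoxerEtAl2021, §2.1.1 and §7.6] -/
def PolarisedResidAutomorphicMod2 (ι : PadicAlgCl 2 ≃+* ℂ) (R : FramedGaloisRep ℚ ℂ 4)
    (χ : absoluteGaloisGroup ℚ →ₜ* ℂˣ) : Prop :=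
  ∃ (hcpt : isCompact_glFiniteIntegralLevel 4 ℚ) (π₀ : CuspidalAutomorphicRepData 4 ℚ hcpt)
    (r : FramedGaloisRep ℚ (PadicAlgCl 2) 4) (χ' : absoluteGaloisGroup ℚ →ₜ* (PadicAlgCl 2)ˣ),
    π₀.1.IsRegularAlgebraic ∧ r.IsSymplecticWithMultiplier χ' ∧
      (∀ g : absoluteGaloisGroup ℚ,
          ‖((χ' g : (PadicAlgCl 2)ˣ) : PadicAlgCl 2) - ι.symm ((χ g : ℂˣ) : ℂ)‖ < 1) ∧
      (∀ᶠ v : IsDedekindDomain.HeightOneSpectrum (NumberField.RingOfIntegers ℚ) in Filter.cofinite,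
        ∃ (α : Multiset ℂ) (P : Polynomial ℂ), π₀.1.HasSatakeParamAt v α ∧
          r.IsUnramifiedAt v ∧ r.HasFrobCharpolyAt v (arithFrobPolyOfSatake ι v.residueCard 4 α) ∧
          R.IsUnramifiedAt v ∧ R.HasFrobCharpolyAt v P ∧
          ∀ i : ℕ, ‖(P.map (ι.symm : ℂ →+* PadicAlgCl 2)).coeff i -
            (arithFrobPolyOfSatake ι v.residueCard 4 α).coeff i‖ < 1)

/-- Forgetting the polarisation: polarised residual automorphy is residual automorphy (sanity lemma, not a
stub; shows the intermediate notion sits between hypothesis and conclusion of the crux). [folklore] -/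
theorem PolarisedResidAutomorphicMod2.residAutomorphicMod2 {ι : PadicAlgCl 2 ≃+* ℂ}
    {R : FramedGaloisRep ℚ ℂ 4} {χ : absoluteGaloisGroup ℚ →ₜ* ℂˣ}
    (h : PolarisedResidAutomorphicMod2 ι R χ) : ResidAutomorphicMod2 ι R := by
  obtain ⟨hcpt, π₀, _r, _χ', hreg, _hsymp, _hχ, hv⟩ := h
  refine ⟨hcpt, π₀, hreg, hv.mono ?_⟩
  rintro v ⟨α, P, hα, -, -, hRur, hRP, hi⟩
  exact ⟨α, P, hα, hRur, hRP, hi⟩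

/-! ## 2. The four stubs -/

/-- **STUB A — structure of the door** (provable; size L in Lean: `Representation.ind` / `tprod` API,
transport of forms along `Representation.Equiv`).  For `L` real quadratic, `ψ` of mixed signature and
`R` an IRREDUCIBLE framed model of `Ind_L^ℚ(ρ|_L ⊗ ψ)`:
(i) TENSOR MODEL — there is an ODD `θ : Γ_ℚ → GL₂(ℂ)` (a framed `Ind_L^ℚ ψ`: `θ(c) ∼ diag(ψ(c₁), ψ(c₂))
= diag(±1, ∓1)` by mixed signature, so `det θ(c) = −1`) with `R ≃ ρ ⊗ θ` (projection formula
`Ind(ρ|_L ⊗ ψ) ≅ ρ ⊗ Ind ψ`, composed with the given `R ≃ Ind σ`, `σ = ψ • ρ|_L`);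
(ii) HYPERBOLIC SYMPLECTIC POLARISATION — `R` is symplectic (`FramedGaloisRep.IsSymplecticWithMultiplier`:
`R(g)ᵀ J R(g) = χ(g) J`, `Jᵀ = −J`, `det J ≠ 0`) with a multiplier `χ` (namely `det ρ · (ψ ∘ Ver_{L/ℚ})`:
`∧²(ρ ⊗ θ) ⊇ det ρ ⊗ Sym² θ ∋ det ρ · (ψ ∘ Ver)` since `θ` preserves the split symmetric form with
multiplier `ψ ∘ Ver`; non-degenerate because `R` is irreducible) whose value at EVERY complex conjugation
is `χ(c) = det ρ(c) · ψ(c₁) ψ(c₂) = −det ρ(c)`;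
(iii) PARITY DICHOTOMY — `ρ` is even (`det ρ(c) = 1` for all `c`) or odd (`FramedGaloisRep.IsOdd`)
(`c² = 1` and all complex conjugations of `Γ_ℚ` are conjugate).
Why it might fail: it does not (finite-group / linear algebra); the Lean risk is the `IndV` coinvariant
model of Mathlib's `Representation.ind`.  Not used: `ρ` irreducible, `2 ∤ disc L`, the non-descent
clause. [cite: Ramakrishnan2000, §3 (cuspidality criterion for `ρ ⊗ θ`)] [cite: BoxerEtAl2021, §7.6] -/
theorem stub_doorStructure (ρ : FramedGaloisRep ℚ ℂ 2) (L : Type) [Field L] [NumberField L]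
    (ψ : FramedGaloisRep L ℂ 1) (R : FramedGaloisRep ℚ ℂ 4)
    (hdeg : Module.finrank ℚ L = 2) (hreal : NumberField.IsTotallyReal L)
    (hdoor : DoorData ρ L ψ R) (hRirr : R.toGaloisRep.IsIrreducible) :
    (∃ θ : FramedGaloisRep ℚ ℂ 2, θ.IsOdd ∧
        Nonempty (R.toGaloisRep.toRepresentation.Equiv
          (ρ.toGaloisRep.toRepresentation.tprod θ.toGaloisRep.toRepresentation))) ∧
    (∃ χ : absoluteGaloisGroup ℚ →ₜ* ℂˣ, R.IsSymplecticWithMultiplier χ ∧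
        ∀ (φ : ℚ →+* ℝ) (c : absoluteGaloisGroup ℚ), IsComplexConjugation φ c →
          ((χ c : ℂˣ) : ℂ) = -((Matrix.GeneralLinearGroup.det (ρ c) : ℂˣ) : ℂ)) ∧
    ((∀ (φ : ℚ →+* ℝ) (c : absoluteGaloisGroup ℚ), IsComplexConjugation φ c →
        Matrix.GeneralLinearGroup.det (ρ c) = 1) ∨ ρ.IsOdd) := by
  sorry

/-- **STUB B — crossing to the polarised component** (residual shadow of the header's
`BigRTUnpolarisedGL4`; difficulty open-problem).  An irreducible `R : Γ_ℚ → GL₄(ℂ)`, symplectic with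
multiplier `χ`, residually automorphic mod 2 from SOME regular algebraic cuspidal `Π₀` of `GL₄(𝔸_ℚ)`, is
residually automorphic mod 2 from a regular algebraic cuspidal `Π₀'` INSIDE its own polarised component
(`PolarisedResidAutomorphicMod2 ι R χ`: `Π₀'` carries a symplectic 2-adic `r'` with multiplier
`≡ ι⁻¹χ mod 𝔪`).  Intended proof: big `R^{unpol}_{R̄₂,S} = 𝐓(K²)_𝔪` for completed cohomology of `GL₄/ℚ`
at `𝔪 = 𝔪_{R̄₂}` (`l₀ = 1`; Calegari–Geraghty, Gee–Newton (conditional), Hansen–Newton Conj. 1.2.3) —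
the point `x_{Π₀}` makes `𝔪` automorphic, `R = 𝐓` makes every deformation of `R̄₂` pro-automorphic, in
particular a regular de Rham SYMPLECTIC lift `r'` with multiplier lifting `χ̄` (Galois-theoretic
existence: Fakhruddin–Khare–Patrikis-type lifting at `p = 2`; `R` itself shows the polarised problem is
non-empty in weight 0), whose classicality is a polarised (`GSp₄`, `l₀ = 0`) statement.  Parity-blind
(`−1 ≡ 1 mod 2`).  Why it might fail: unpolarised `R = 𝐓` at `l₀ = 1` is conjectural; `p = 2` with
`im R̄₂ ≅ SL₂(𝔽₄) ⊗ dihedral` may fail every published adequacy/genericity hypothesis; symplectic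
geometric lifting theorems exclude `p = 2`; equivalently this is a Serre-type residual automorphy
statement for `GSp₄/ℚ` in the `χ̄`-component, which no one has. [cite: CalegariGeraghty2017, §1] [cite: GeeNewton2020, Thm. 1.3] [cite: HansenUniversalEigenvarieties2017, Conj. 1.2.3] -/
theorem stub_polarisedResidualLift (ι : PadicAlgCl 2 ≃+* ℂ) (R : FramedGaloisRep ℚ ℂ 4)
    (χ : absoluteGaloisGroup ℚ →ₜ* ℂˣ) (hRirr : R.toGaloisRep.IsIrreducible)
    (hsymp : R.IsSymplecticWithMultiplier χ) (hres : ResidAutomorphicMod2 ι R) :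
    PolarisedResidAutomorphicMod2 ι R χ := by
  sorry

/-- **STUB C — the `GSp₄`-odd family at the Artin point** (shadow of the header's
`OrdinaryGSp4FamilyAtArtinPoint`; difficulty open-problem, inside the `l₀ = 0` technique class).  An
irreducible `R : Γ_ℚ → GL₄(ℂ)`, symplectic with ODD multiplier `χ` (`χ(c) = −1` at every complex
conjugation — the `GSp₄`-oddness of Boxer–Calegari–Gee–Pilloni §7.6, the parity of abelian surfaces),
residually automorphic mod 2 inside its own polarised component, is a 2-adic limit of regular algebraic
cuspidal representations of `GL₄(𝔸_ℚ)`: `LimitToPrecision ι R s` for every `s`.  Intended proof: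
polarised `R^{pol} = 𝐓^{GSp₄}_𝔪` at `p = 2` (BCGP-type patching of Hida / overconvergent coherent
cohomology of Siegel threefolds) puts `x_R` on the tame-level `GSp₄` eigenvariety as a non-classical Artin
point of singular weight (Bellaïche–Chenevier's Artin points, for `GSp₄`); the cuspidal eigenvariety is
equidimensional of dimension 2 over weight space (Andreatta–Iovita–Pilloni, Hansen–Newton), so classical
points of regular weights `2`-adically close to `w(x_R)` and small slope ACCUMULATE at `x_R`; Arthur's
transfer `GSp₄ → GL₄` of the (stable, for `s ≫ 0`) approximants gives cuspidal regular algebraic `Π_s`.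
Why it might fail: `x_R` of infinite slope at 2 (`R|_{Γ_{ℚ₂}}` irreducible) lies on no finite-slope
eigenvariety; `R^{pol} = 𝐓` for `GSp₄` at `p = 2` with residual image `SL₂(𝔽₄) ⊗ dihedral` is beyond
BCGP (`p ≥ 3`, vast and tidy image); without ODD multiplier the statement is expected FALSE (regular
symplectic `Π` on `GL₄/ℚ` have odd similitude: an even-multiplier Artin point sits in a component with no
classical points — Calegari–Mazur / Ash–Pollack–Stevens rigidity), hence the hypothesis. [cite: BoxerEtAl2021, Thm. 1.1.3 and §7.6] [cite: HansenUniversalEigenvarieties2017, Thm. 1.1.6] [cite: AshPollackStevens2007, Conj. 1] [cite: CalegariMazur2008, Conj. 1.3] -/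
theorem stub_polarisedAccumulation (ι : PadicAlgCl 2 ≃+* ℂ) (R : FramedGaloisRep ℚ ℂ 4)
    (χ : absoluteGaloisGroup ℚ →ₜ* ℂˣ) (hRirr : R.toGaloisRep.IsIrreducible)
    (hsymp : R.IsSymplecticWithMultiplier χ)
    (hodd : ∀ (φ : ℚ →+* ℝ) (c : absoluteGaloisGroup ℚ), IsComplexConjugation φ c →
      ((χ c : ℂˣ) : ℂ) = -1)
    (hpol : PolarisedResidAutomorphicMod2 ι R χ) (s : ℕ) : LimitToPrecision ι R s := by
  sorry

/-- **STUB D — the classical parity: odd ⊗ odd** (`GO₄ ≅ (GL₂ × GL₂)/GL₁` technology; theorem-sized when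
both factors have finite slope at 2, open at infinite slope).  If `R : Γ_ℚ → GL₄(ℂ)` is irreducible and
`R ≃ r₁ ⊗ r₂` for two ODD `r₁, r₂ : Γ_ℚ → GL₂(ℂ)` (continuous, hence Artin), then `R` is a 2-adic limit
of regular algebraic cuspidal representations of `GL₄(𝔸_ℚ)`: `LimitToPrecision ι R s` for every `s` and
every `ι`.  Intended proof: `r₁, r₂` are irreducible (as `R` is) and odd, hence modular of weight one
(Khare–Wintenberger + Kisin: Serre's conjecture ⇒ Artin for odd `GL₂/ℚ`); the 2-adic Hida / Coleman
families through the two weight-one points of the tame-level eigencurves contain classical eigenforms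
`f_k ≡ f`, `g_{k'} ≡ g (mod 2^s)` of weights `k ≠ k'`, both `→ 1` 2-adically (accumulation of classical
points on the eigencurve: Coleman's small-slope classicality, Buzzard–Kilford at `p = 2`); `Π_s :=
f_k ⊠ g_{k'}` (Ramakrishnan's `GL₂ × GL₂ → GL₄`) is cuspidal (no twist-equivalence at distinct large
weights) and regular algebraic (`HT {0, k'−1, k−1, k+k'−2}`), and `r_ι(Π_s) = r_{f_k} ⊗ r_{g_{k'}} ≡
r₁ ⊗ r₂ (mod 2^s)` at all unramified `v`.  Why it might fail: if `r₁|_{Γ_{ℚ₂}}` (or `r₂`) is irreducible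
after every twist (infinite slope at 2 — allowed: nothing in the crux controls ramification of `ρ`, `ψ`
at 2), the weight-one point lies on no finite-slope family and the accumulation of regular classical
eigenforms at it (fixed tame level, 2-power level free) is not known; the `(√q)^{m−1}`-normalisation of
`arithFrobPolyOfSatake ι q 4 α` against the unitary Satake parameter of `f_k ⊠ g_{k'}` must produce
2-adic units (typing sanity (c) of the route, checked by the refuter for the crux itself).
[cite: KhareWintenberger2009, Thm. 1.2] [cite: Ramakrishnan2000, Thm. M] [cite: BuzzardKilford2005, Thm. A] -/
theorem stub_oddTensorLimit (ι : PadicAlgCl 2 ≃+* ℂ) (r₁ r₂ : FramedGaloisRep ℚ ℂ 2)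
    (R : FramedGaloisRep ℚ ℂ 4) (h₁ : r₁.IsOdd) (h₂ : r₂.IsOdd)
    (hR : Nonempty (R.toGaloisRep.toRepresentation.Equiv
      (r₁.toGaloisRep.toRepresentation.tprod r₂.toGaloisRep.toRepresentation)))
    (hRirr : R.toGaloisRep.IsIrreducible) (s : ℕ) : LimitToPrecision ι R s := by
  sorry

/-! ## 3. The stub statements as named `Prop`s (literally the types of the stubs; no `sorry` inherited) -/

namespace _Goal

/-- The statement of `stub_doorStructure`, as a named `Prop` (literally its type). [folklore] -/
def stub_doorStructure : Prop :=
  type_of% @Summit.Langlands.Langlands.Cruxes.TwoAdicProAutomorphyGL4.Birth.stub_doorStructure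

/-- The statement of `stub_polarisedResidualLift`, as a named `Prop` (literally its type). [folklore] -/
def stub_polarisedResidualLift : Prop :=
  type_of% @Summit.Langlands.Langlands.Cruxes.TwoAdicProAutomorphyGL4.Birth.stub_polarisedResidualLift

/-- The statement of `stub_polarisedAccumulation`, as a named `Prop` (literally its type). [folklore] -/
def stub_polarisedAccumulation : Prop :=
  type_of% @Summit.Langlands.Langlands.Cruxes.TwoAdicProAutomorphyGL4.Birth.stub_polarisedAccumulation

/-- The statement of `stub_oddTensorLimit`, as a named `Prop` (literally its type). [folklore] -/
def stub_oddTensorLimit : Prop :=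
  type_of% @Summit.Langlands.Langlands.Cruxes.TwoAdicProAutomorphyGL4.Birth.stub_oddTensorLimit

end _Goal

/-! ## 4. The composition (kernel-checked, no `sorry`):
STRUCTURE → (even ρ) COMPONENT CROSSING → `GSp₄`-ODD ACCUMULATION / (odd ρ) ODD ⊗ ODD → crux by name -/

/-- **The crux from the four stubs.**  Given the crux data `(ι, ρ, L, ψ, R)`: STUB A turns the door data
and the irreducibility of `R` into the tensor model `R ≃ ρ ⊗ θ` (`θ` odd), the symplectic datum `χ` with
`χ(c) = −det ρ(c)`, and the parity dichotomy for `ρ`.  If `ρ` is EVEN, `χ(c) = −1`: STUB B moves the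
residual automorphy of the crux into `R`'s own polarised component and STUB C (the `GSp₄`-odd family)
produces the regular algebraic cuspidal approximants to every precision.  If `ρ` is ODD, STUB D (odd ⊗
odd) produces them from the tensor model.  Hypotheses are, by name, the statements of the four stubs;
the conclusion is the route decl `TwoAdicProAutomorphyGL4`. [folklore] -/
theorem TwoAdicProAutomorphyGL4_of (hA : _Goal.stub_doorStructure)
    (hB : _Goal.stub_polarisedResidualLift) (hC : _Goal.stub_polarisedAccumulation)
    (hD : _Goal.stub_oddTensorLimit) : TwoAdicProAutomorphyGL4 := by
  -- read the four named statements
  have hStruct : ∀ (ρ : FramedGaloisRep ℚ ℂ 2) (L : Type) [Field L] [NumberField L]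
      (ψ : FramedGaloisRep L ℂ 1) (R : FramedGaloisRep ℚ ℂ 4),
      Module.finrank ℚ L = 2 → NumberField.IsTotallyReal L → DoorData ρ L ψ R →
        R.toGaloisRep.IsIrreducible →
        (∃ θ : FramedGaloisRep ℚ ℂ 2, θ.IsOdd ∧
            Nonempty (R.toGaloisRep.toRepresentation.Equiv
              (ρ.toGaloisRep.toRepresentation.tprod θ.toGaloisRep.toRepresentation))) ∧
        (∃ χ : absoluteGaloisGroup ℚ →ₜ* ℂˣ, R.IsSymplecticWithMultiplier χ ∧
            ∀ (φ : ℚ →+* ℝ) (c : absoluteGaloisGroup ℚ), IsComplexConjugation φ c →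
              ((χ c : ℂˣ) : ℂ) = -((Matrix.GeneralLinearGroup.det (ρ c) : ℂˣ) : ℂ)) ∧
        ((∀ (φ : ℚ →+* ℝ) (c : absoluteGaloisGroup ℚ), IsComplexConjugation φ c →
            Matrix.GeneralLinearGroup.det (ρ c) = 1) ∨ ρ.IsOdd) := hA
  have hCross : ∀ (ι : PadicAlgCl 2 ≃+* ℂ) (R : FramedGaloisRep ℚ ℂ 4)
      (χ : absoluteGaloisGroup ℚ →ₜ* ℂˣ), R.toGaloisRep.IsIrreducible →
        R.IsSymplecticWithMultiplier χ → ResidAutomorphicMod2 ι R →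
          PolarisedResidAutomorphicMod2 ι R χ := hB
  have hAccum : ∀ (ι : PadicAlgCl 2 ≃+* ℂ) (R : FramedGaloisRep ℚ ℂ 4)
      (χ : absoluteGaloisGroup ℚ →ₜ* ℂˣ), R.toGaloisRep.IsIrreducible →
        R.IsSymplecticWithMultiplier χ →
          (∀ (φ : ℚ →+* ℝ) (c : absoluteGaloisGroup ℚ), IsComplexConjugation φ c →
            ((χ c : ℂˣ) : ℂ) = -1) →
            PolarisedResidAutomorphicMod2 ι R χ → ∀ s : ℕ, LimitToPrecision ι R s := hC
  have hOddOdd : ∀ (ι : PadicAlgCl 2 ≃+* ℂ) (r₁ r₂ : FramedGaloisRep ℚ ℂ 2)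
      (R : FramedGaloisRep ℚ ℂ 4), r₁.IsOdd → r₂.IsOdd →
        Nonempty (R.toGaloisRep.toRepresentation.Equiv
          (r₁.toGaloisRep.toRepresentation.tprod r₂.toGaloisRep.toRepresentation)) →
          R.toGaloisRep.IsIrreducible → ∀ s : ℕ, LimitToPrecision ι R s := hD
  -- the crux, clause by clause
  rw [crux_iff]
  intro ι ρ L _ _ ψ R _hρirr hdeg hreal _hdisc hdoor hRirr hres s
  -- STUB A: tensor model, hyperbolic symplectic polarisation, parity dichotomy
  obtain ⟨⟨θ, hθodd, hRθ⟩, ⟨χ, hsymp, hχc⟩, hparity⟩ := hStruct ρ L ψ R hdeg hreal hdoor hRirr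
  rcases hparity with heven | hodd
  · -- EVEN ρ: the multiplier is odd, `χ(c) = -det ρ(c) = -1`
    have hχodd : ∀ (φ : ℚ →+* ℝ) (c : absoluteGaloisGroup ℚ), IsComplexConjugation φ c →
        ((χ c : ℂˣ) : ℂ) = -1 := by
      intro φ c hc
      rw [hχc φ c hc, heven φ c hc, Units.val_one]
    -- STUB B: residual automorphy inside the polarised component of `R`
    have hpol : PolarisedResidAutomorphicMod2 ι R χ := hCross ι R χ hRirr hsymp hres
    -- STUB C: accumulation of regular classical points in the `GSp₄`-odd family
    exact hAccum ι R χ hRirr hsymp hχodd hpol s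
  · -- ODD ρ: `R ≃ ρ ⊗ θ` with both factors odd — STUB D
    exact hOddOdd ι ρ θ R hodd hθodd hRθ hRirr s

/-- By-name sanity check (an `example`, so it is not a declaration of the file): the four stubs feed the
composition as they stand. -/
example : TwoAdicProAutomorphyGL4 :=
  TwoAdicProAutomorphyGL4_of stub_doorStructure stub_polarisedResidualLift stub_polarisedAccumulation
    stub_oddTensorLimit

end Summit.Langlands.Langlands.Cruxes.TwoAdicProAutomorphyGL4.Birth

end
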